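import Mathlib
import Summits.Ventures.HodgeRepro2.T5FiniteZeros
import Summits.Ventures.HodgeRepro2.T5FiniteZerosCharacters
import Summits.Ventures.HodgeRepro2.T5LambdaInvariant

/-!
# T5LambdaInvariantDVR — the μ- and λ-invariants of a power series over ANY complete DVR, and
`#{ν : ∫ν dm = 0} ≤ λ(f_m)` for measures with values in `W`

Cell pub-hodge-repro2, Tier 5 support (seat p7; route/T5-CHECK-G-p7.md §3 S5). S5 is printed for the
Katz measure with values in `W = W(𝔽̄_p)` — a complete DVR that is NOT `ℤ_p` — and [P3] «for any complete
DVR». T5LambdaInvariant (p401279) proved «`#Z ≤ λ`» on the model `R = ℤ_p`, because the μ-invariant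
`mu` of T5MuInvariantPadic is `ℤ_p`-specific. This file removes that restriction: the invariants are
defined on the POWER SERIES over an arbitrary DVR `A` (p8's setting for T5FiniteZeros), through Mathlib's
`IsDiscreteValuationRing.addVal`:

* `muSeries f := ⨅ n, addVal A (coeff_n f)` and `lambdaSeries f := min {n : addVal A (coeff_n f) = μ(f)}`;
  `muSeries_eq_of_eq_C_pow_mul` (the normalised form `f = ϖ^k · g`, `g` with a unit coefficient — p8's
  `exists_eq_C_pow_mul` — has `μ(f) = k`), `order_map_residue_eq_lambdaSeries` (`λ(f)` is the order of `g mod 𝔪`);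
* `exists_weierstrass`: for `f ≠ 0` over a complete DVR, `f = ϖ^μ · (P · U)` with `P` distinguished of
  degree `λ(f)` and `U` a unit (Mathlib's Weierstrass preparation);
* `ncard_zeroSet_le_lambdaSeries`: for a continuous `m ≠ 0` on `C(ℤ_p, A)` with `A` a complete DVR as in
  T5FiniteZerosCharacters (e.g. `W`), `#{κ continuous : ∫κ dm = 0} ≤ λ(f_m)` — S5's «|Z_i| ≤ deg P_i» for
  `W`-valued measures, the degree named;
* on `ℤ_p` the new invariants agree with the old: `vp_eq_addVal`, `muSeries_amice_eq_mu`,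
  `lambdaSeries_amice_eq_lambda`.

Mathlib + own T5FiniteZerosCharacters (hence p8's T5FiniteZeros), T5LambdaInvariant only.
-/

namespace Summit.Ventures.HodgeRepro2.T5LambdaInvariantDVR

open PadicInt Filter Topology IsDiscreteValuationRing
open Summit.Ventures.HodgeRepro2
open Summit.Ventures.HodgeRepro2.T5AmiceTransform

/-! ### The invariants of a power series over a DVR -/

section Series

variable {A : Type*} [CommRing A] [IsDomain A] [IsDiscreteValuationRing A]

/-- The μ-invariant of a power series: the minimum valuation of its coefficients. -/
noncomputable def muSeries (f : PowerSeries A) : ℕ∞ := ⨅ n, addVal A (PowerSeries.coeff n f)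

/-- The λ-invariant of a power series: the first index at which the minimum valuation is attained. -/
noncomputable def lambdaSeries (f : PowerSeries A) : ℕ :=
  sInf {n : ℕ | addVal A (PowerSeries.coeff n f) = muSeries f}

/-- `μ(f) ≤ addVal (coeff_n f)`. -/
theorem muSeries_le (f : PowerSeries A) (n : ℕ) : muSeries f ≤ addVal A (PowerSeries.coeff n f) :=
  iInf_le _ n

/-- `μ(f) = ⊤ ⟺ f = 0`. -/
theorem muSeries_eq_top_iff (f : PowerSeries A) : muSeries f = ⊤ ↔ f = 0 := by
  rw [muSeries, iInf_eq_top]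
  constructor
  · intro h
    ext n
    simpa [addVal_eq_top_iff] using h n
  · rintro rfl n
    simp

/-- The minimum valuation is attained (for `f = 0` at every index, with value `⊤`). -/
theorem exists_addVal_coeff_eq_muSeries (f : PowerSeries A) :
    ∃ n, addVal A (PowerSeries.coeff n f) = muSeries f := by
  have hmem := csInf_mem (Set.range_nonempty fun n => addVal A (PowerSeries.coeff n f))
  obtain ⟨n, hn⟩ := hmem
  exact ⟨n, hn⟩

/-- `addVal (coeff_{λ(f)} f) = μ(f)`. -/
theorem addVal_coeff_lambdaSeries (f : PowerSeries A) :
    addVal A (PowerSeries.coeff (lambdaSeries f) f) = muSeries f :=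
  Nat.sInf_mem (exists_addVal_coeff_eq_muSeries f)

/-- `λ(f) ≤ n` whenever the minimum is attained at `n`. -/
theorem lambdaSeries_le {f : PowerSeries A} {n : ℕ}
    (h : addVal A (PowerSeries.coeff n f) = muSeries f) : lambdaSeries f ≤ n :=
  Nat.sInf_le h

/-- The normalised form `f = ϖ^k · g` with `g` having a unit coefficient has `μ(f) = k`. -/
theorem muSeries_eq_of_eq_C_pow_mul {ϖ : A} (hϖ : Irreducible ϖ) {f g : PowerSeries A} {k : ℕ}
    (hfg : f = PowerSeries.C (ϖ ^ k) * g) (hunit : ∃ n, IsUnit (PowerSeries.coeff n g)) :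
    muSeries f = k := by
  have hcoeff : ∀ n, addVal A (PowerSeries.coeff n f) = k + addVal A (PowerSeries.coeff n g) := by
    intro n
    rw [hfg, PowerSeries.coeff_C_mul, addVal_mul, hϖ.addVal_pow]
  obtain ⟨n₀, hn₀⟩ := hunit
  apply le_antisymm
  · refine (muSeries_le f n₀).trans ?_
    rw [hcoeff, addVal_eq_zero_iff.mpr hn₀, add_zero]
  · exact le_iInf fun n => by rw [hcoeff]; exact le_self_add

/-- `λ(f)` is the order of `g mod 𝔪` for the normalised form `f = ϖ^k · g`. -/
theorem order_map_residue_eq_lambdaSeries {ϖ : A} (hϖ : Irreducible ϖ) {f g : PowerSeries A} {k : ℕ}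
    (hfg : f = PowerSeries.C (ϖ ^ k) * g) (hunit : ∃ n, IsUnit (PowerSeries.coeff n g)) :
    (g.map (IsLocalRing.residue A)).order = lambdaSeries f := by
  have hk := muSeries_eq_of_eq_C_pow_mul hϖ hfg hunit
  have hcoeff : ∀ n, addVal A (PowerSeries.coeff n f) = k + addVal A (PowerSeries.coeff n g) := by
    intro n
    rw [hfg, PowerSeries.coeff_C_mul, addVal_mul, hϖ.addVal_pow]
  have hunit' : ∀ n, IsUnit (PowerSeries.coeff n g) ↔
      addVal A (PowerSeries.coeff n f) = muSeries f := by
    intro n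
    rw [← addVal_eq_zero_iff, hcoeff n, hk]
    constructor
    · intro h
      rw [h, add_zero]
    · intro h
      have h' : (k : ℕ∞) + addVal A (PowerSeries.coeff n g) = (k : ℕ∞) + 0 := by rw [h, add_zero]
      exact WithTop.add_left_cancel (WithTop.natCast_ne_top k) h'
  have hres : ∀ n, PowerSeries.coeff n (g.map (IsLocalRing.residue A)) ≠ 0 ↔
      IsUnit (PowerSeries.coeff n g) := by
    intro n
    rw [PowerSeries.coeff_map, Ne, IsLocalRing.residue_eq_zero_iff, IsLocalRing.notMem_maximalIdeal]
  rw [PowerSeries.order_eq_nat]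
  refine ⟨?_, fun i hi => ?_⟩
  · rw [hres, hunit']
    exact addVal_coeff_lambdaSeries f
  · by_contra h
    change PowerSeries.coeff i (g.map (IsLocalRing.residue A)) ≠ 0 at h
    rw [hres, hunit'] at h
    exact absurd (lambdaSeries_le h) (not_le.mpr hi)

/-- WEIERSTRASS PREPARATION over a complete DVR with the degree named: for `f ≠ 0`,
`f = ϖ^{μ(f)} · (P · U)` with `P` distinguished of degree `λ(f)` and `U` a unit. -/
theorem exists_weierstrass [IsAdicComplete (IsLocalRing.maximalIdeal A) A] {ϖ : A}
    (hϖ : Irreducible ϖ) {f : PowerSeries A} (hf : f ≠ 0) :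
    ∃ (k : ℕ) (P : Polynomial A) (U : PowerSeries A),
      muSeries f = k ∧ P.IsDistinguishedAt (IsLocalRing.maximalIdeal A) ∧ IsUnit U ∧
      P.natDegree = lambdaSeries f ∧ f = PowerSeries.C (ϖ ^ k) * (↑P * U) := by
  obtain ⟨k, g, hfg, hunit⟩ := T5FiniteZeros.exists_eq_C_pow_mul hϖ hf
  obtain ⟨n₀, hn₀⟩ := hunit
  have hgmap : g.map (IsLocalRing.residue A) ≠ 0 :=
    T5FiniteZeros.map_residue_ne_zero_of_isUnit_coeff hn₀
  obtain ⟨P, U, H⟩ := PowerSeries.exists_isWeierstrassFactorization hgmap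
  refine ⟨k, P, U, muSeries_eq_of_eq_C_pow_mul hϖ hfg ⟨n₀, hn₀⟩, H.isDistinguishedAt, H.isUnit, ?_, ?_⟩
  · rw [H.natDegree_eq_toNat_order_map, order_map_residue_eq_lambdaSeries hϖ hfg ⟨n₀, hn₀⟩]
    rfl
  · rw [hfg, H.eq_mul]

end Series

/-! ### `#{ν : ∫ν dm = 0} ≤ λ(f_m)` for measures with values in a complete DVR (e.g. `W`) -/

section Measures

variable {p : ℕ} [hp : Fact p.Prime]
variable {R : Type*} [NormedCommRing R] [Algebra ℤ_[p] R] [IsBoundedSMul ℤ_[p] R]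
  [IsUltrametricDist R] [CompleteSpace R] [IsLinearTopology R R] [IsDomain R]
  [IsDiscreteValuationRing R] [IsAdicComplete (IsLocalRing.maximalIdeal R) R]

/-- S5's COUNT for measures with values in ANY complete DVR `R` (the Katz measure's `W`):
`#{κ continuous : ∫κ dm = 0} ≤ λ(f_m)` for a continuous `m ≠ 0`. -/
theorem ncard_zeroSet_le_lambdaSeries (m : C(ℤ_[p], R) →ₗ[R] R) (hm : Continuous m) (hne : m ≠ 0) :
    {κ : {κ : AddChar ℤ_[p] R // Continuous κ} | m ⟨κ.1, κ.2⟩ = 0}.ncard ≤ lambdaSeries (amice m) := by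
  obtain ⟨ϖ, hϖ⟩ := exists_irreducible R
  have hf : amice m ≠ 0 := (amice_ne_zero_iff m hm).mpr hne
  obtain ⟨k, P, U, -, hP, hU, hdeg, hfact⟩ := exists_weierstrass hϖ hf
  have hP0 : P ≠ 0 := hP.monic.ne_zero
  have hc : ϖ ^ k ≠ 0 := pow_ne_zero _ hϖ.ne_zero
  classical
  have hsub : ∀ κ ∈ {κ : {κ : AddChar ℤ_[p] R // Continuous κ} | m ⟨κ.1, κ.2⟩ = 0},
      κ.1 1 - 1 ∈ (↑P.roots.toFinset : Set R) := by
    intro κ hκ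
    simp only [Set.mem_setOf_eq] at hκ
    rw [Finset.mem_coe, Multiset.mem_toFinset, Polynomial.mem_roots hP0]
    have h := T5FiniteZeros.isRoot_of_eval_eq_zero hc hU hfact
      (PowerSeries.aeval (hasEval_eval_one_sub_one κ.1 κ.2))
      (by rw [aeval_amice_eq_map m hm κ.1 κ.2]; exact hκ)
    rwa [T5FiniteZerosCharacters.aeval_X_eq] at h
  calc {κ : {κ : AddChar ℤ_[p] R // Continuous κ} | m ⟨κ.1, κ.2⟩ = 0}.ncard
      ≤ (↑P.roots.toFinset : Set R).ncard :=
        Set.ncard_le_ncard_of_injOn _ hsub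
          (T5PadicFiniteOrderCharacters.eval_one_sub_one_injective.injOn) (Finset.finite_toSet _)
    _ = P.roots.toFinset.card := Set.ncard_coe_finset _
    _ ≤ P.roots.card := Multiset.toFinset_card_le _
    _ ≤ P.natDegree := Polynomial.card_roots' P
    _ = lambdaSeries (amice m) := hdeg

/-- `λ(f_m) = 0` ⇒ no continuous character is killed by `m` (any complete DVR `R`). -/
theorem map_ne_zero_of_lambdaSeries_eq_zero (m : C(ℤ_[p], R) →ₗ[R] R) (hm : Continuous m)
    (hne : m ≠ 0) (hl : lambdaSeries (amice m) = 0) (κ : AddChar ℤ_[p] R) (hκ : Continuous κ) :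
    m ⟨κ, hκ⟩ ≠ 0 := by
  intro h0
  have hfin := T5FiniteZerosCharacters.finite_zeroSet_addChar m hm hne
  have hmem : (⟨κ, hκ⟩ : {κ : AddChar ℤ_[p] R // Continuous κ}) ∈
      {κ : {κ : AddChar ℤ_[p] R // Continuous κ} | m ⟨κ.1, κ.2⟩ = 0} := h0
  have hpos : 0 < {κ : {κ : AddChar ℤ_[p] R // Continuous κ} | m ⟨κ.1, κ.2⟩ = 0}.ncard :=
    Set.ncard_pos hfin |>.mpr ⟨_, hmem⟩
  have := ncard_zeroSet_le_lambdaSeries m hm hne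
  rw [hl] at this
  exact absurd this (not_le.mpr hpos)

end Measures

/-! ### On `ℤ_p` the new invariants are the old ones -/

section Padic

open Summit.Ventures.HodgeRepro2.T5MuInvariantPadic
open Summit.Ventures.HodgeRepro2.T5MuInvariantAmice
open Summit.Ventures.HodgeRepro2.T5LambdaInvariant

variable {p : ℕ} [hp : Fact p.Prime]

/-- `vp p x = addVal ℤ_p x`: T5MuInvariantPadic's valuation is Mathlib's DVR valuation of `ℤ_p`. -/
theorem vp_eq_addVal (x : ℤ_[p]) : vp p x = addVal ℤ_[p] x := by
  rcases eq_or_ne x 0 with rfl | hx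
  · rw [vp_zero, addVal_zero]
  · rw [vp_of_ne_zero p hx, addVal_def x (unitCoeff hx) irreducible_p x.valuation (unitCoeff_spec hx)]

/-- `μ(f_m) = mu p m` on `ℤ_p` (bounded `m`). -/
theorem muSeries_amice_eq_mu (m : C(ℤ_[p], ℤ_[p]) →ₗ[ℤ_[p]] ℤ_[p]) {C : ℝ} (hC : 0 ≤ C)
    (hb : ∀ φ, ‖m φ‖ ≤ C * ‖φ‖) : muSeries (amice m) = mu p m := by
  rw [mu_eq_iInf_vp_coeff m hC hb, muSeries]
  exact iInf_congr fun n => (vp_eq_addVal _).symm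

/-- `λ(f_m) = lambda m` on `ℤ_p` (bounded `m`). -/
theorem lambdaSeries_amice_eq_lambda (m : C(ℤ_[p], ℤ_[p]) →ₗ[ℤ_[p]] ℤ_[p]) {C : ℝ} (hC : 0 ≤ C)
    (hb : ∀ φ, ‖m φ‖ ≤ C * ‖φ‖) : lambdaSeries (amice m) = lambda m := by
  unfold lambdaSeries lambda
  congr 1
  ext n
  rw [Set.mem_setOf_eq, Set.mem_setOf_eq, muSeries_amice_eq_mu m hC hb, vp_eq_addVal]

end Padic

end Summit.Ventures.HodgeRepro2.T5LambdaInvariantDVR
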